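import Mathlib
import Summits.NavierStokesRegularity.NavierStokesRegularity.Theorems.EulerZoomLiouvillePowerGaugeEulerLiouvilleSelfSimilarTopBadNodeGrowthTravel
import Summits.NavierStokesRegularity.NavierStokesRegularity.Theorems.EulerZoomLiouvillePowerGaugeEulerLiouvilleSelfSimilarTopBadNodeTubeDynamics
import HarnessLib.Audit

/-!
# Rung C1 of the crux `EulerZoomLiouville.PowerGaugeEulerLiouville`: the no-exit lemma, CASE (NT-arc) — CAP EXIT ACROSS
# AN ARC SLAB (blueprint §2, `false_of_exit_arcSide`)

Route №10 `EulerZoomLiouville` (NavierStokesRegularity), crux E = stmt-NavierStokesRegularity-19832,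
tenure rung C1 (exactly self-similar members), registered residue `stub_selfSimilarExtremal`.
Twenty-sixth file of the NODAL-CONTINUUM line (lineage ns-typeII-p1, gen 7).  Setting of the no-exit lemma at the
degenerate top bad node `z`: kernel graph `τ ↦ z + τe + g(τ)` with `V = φe` on it (`|τ| ≤ δ`), backward trajectory `Y`
on `[0, t₁]` in `B̄(z, r)` starting `ε`-close to `z`, never stagnant, tube coordinates `σ = ⟪e, Y − z⟫`,
`ξ = Y − z − σe − g(σ)`, eigenframe splitting `p + m = |ξ|²` with the forced inequalities of `tube_inequalities`
(`Λ = Lr`), kernel-coordinate derivative `σ' = −φ(σ) − ⟪e, E⟫`, `|E| ≤ ρ|ξ|`.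

* `false_of_exit_arcSide` — NO THRESHOLD (`p + m < 2(1+K)Θ` throughout), the trajectory reaches `σ(t₁) ≥ r/2`, and
  `φ ≡ 0` on the slab `[r/4, r/2]` (an ARC of stagnation points on the exit side): contradiction.  Along the last crossing
  `[t_in, t_out]` of the slab (`σ(t_in) = r/4`, `σ(t_out) = r/2`, `σ ∈ [r/4, r/2]` in between — two `sSup`/`sInf`
  selections) the inequalities are UNFORCED, `ξ ≠ 0` (else `Y` would sit at a stagnation point), and
  `|σ'| ≤ ρ|ξ| = ρ√(p+m)`; `slab_travel_le` (shifted to `[0, t_out − t_in]`) bounds the travel `r/4` by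
  `6ρ√((1+K)·2(1+K)Θ)/μ ≤ r/8` (`√Θ ≤ √κ M₁ + 3√(1+K)ε`, `M₁ ≤ C₁r²`, smallness `hrArc`, `hεArc`).

WHAT THIS IS NOT: not NS, not E, not yet the no-exit lemma — one of its three cases.
[cite: ConstantinIgnatovaVicol2026Putative, §3.4.3–§3.5, §4 (local analysis not in print)] [cite: KatokHasselblatt1995, §6.2]
-/

noncomputable section

-- flat `Theorems/<Route><Decl>…` files of one crux share the namespace of the crux (tree convention)
set_option linter.dupNamespace false

open Set Filter Topology Metric Function InnerProductSpace
open scoped RealInnerProductSpace NNReal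

namespace Summit.NavierStokesRegularity.NavierStokesRegularity.Theorems.PowerGaugeEulerLiouville.NodalContinuum

open Literature.Analysis Literature.Analysis.FluidPDE Literature.Analysis.ODE

variable {γ : ℝ} {c : EuclideanSpace ℝ (Fin 3)}
  {U : EuclideanSpace ℝ (Fin 3) → EuclideanSpace ℝ (Fin 3)}

/-- `√Θ ≤ √κ·M₁ + 3√(1+K)·ε` for `Θ = κM₁² + 9(1+K)ε²` (subadditivity of `√`). [folklore] -/
theorem sqrt_threshold_le {κ M₁ K ε : ℝ} (hκ : 0 ≤ κ) (hM₁ : 0 ≤ M₁) (hK : 0 ≤ 1 + K) (hε : 0 ≤ ε) :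
    Real.sqrt (κ * M₁ ^ 2 + 9 * (1 + K) * ε ^ 2) ≤ Real.sqrt κ * M₁ + 3 * Real.sqrt (1 + K) * ε := by
  have hs1 := Real.sq_sqrt hκ
  have hs2 := Real.sq_sqrt hK
  have hn1 := Real.sqrt_nonneg κ
  have hn2 := Real.sqrt_nonneg (1 + K)
  rw [Real.sqrt_le_left (by positivity)]
  nlinarith [mul_nonneg (mul_nonneg hn1 hM₁) (mul_nonneg hn2 hε)]

set_option maxHeartbeats 800000 in
/-- **CASE (NT-arc) of the no-exit lemma: no threshold, cap exit across an arc slab ⇒ contradiction.**  See the module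
docstring; hypotheses = the relevant part of the blueprint's COMMON HYPOTHESES + the case data.
[cite: ConstantinIgnatovaVicol2026Putative, §3.4.3–§3.5, §4 (local analysis not in print)] [cite: KatokHasselblatt1995, §6.2 (cone criterion)] -/
theorem false_of_exit_arcSide
    {z e : EuclideanSpace ℝ (Fin 3)} (he1 : ‖e‖ = 1)
    {A : EuclideanSpace ℝ (Fin 3) →L[ℝ] EuclideanSpace ℝ (Fin 3)} {μ α K : ℝ} (hμ : 0 < μ) (hμα : μ ≤ α)
    (hK : K = 2 * α / μ + 1)
    -- the kernel graph and `V = φ e` on it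
    {g : ℝ → EuclideanSpace ℝ (Fin 3)} {φ : ℝ → ℝ} {δ L C₁ : ℝ}
    (hpar : ∀ τ, |τ| ≤ δ → selfSimilarTransport γ c U (z + τ • e + g τ) = φ τ • e)
    -- the trajectory
    {Y : ℝ → EuclideanSpace ℝ (Fin 3)} {r ε ρ t₁ : ℝ} (hr : 0 < r) (hrδ : 4 * r ≤ δ) (hε : 0 < ε) (hεr : ε ≤ r / 8)
    (hρ : 0 < ρ)
    (hY : ∀ t, HasDerivAt Y ((-1 : ℝ) • selfSimilarTransport γ c U (Y t)) t) (ht₁ : 0 < t₁)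
    (hin : ∀ t ∈ Icc 0 t₁, ‖Y t - z‖ ≤ r) (hY0 : ‖Y 0 - z‖ < ε)
    (hstag : ∀ t ∈ Icc 0 t₁, selfSimilarTransport γ c U (Y t) ≠ 0)
    -- tube coordinates and the eigenframe splitting
    {σ p m pd md : ℝ → ℝ} {ξ : ℝ → EuclideanSpace ℝ (Fin 3)} (hσ : ∀ t, σ t = ⟪e, Y t - z⟫)
    (hξ : ∀ t, ξ t = Y t - z - σ t • e - g (σ t))
    (hpm : ∀ t, p t + m t = ‖ξ t‖ ^ 2) (hpnn : ∀ t, 0 ≤ p t) (hmnn : ∀ t, 0 ≤ m t)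
    (hp' : ∀ t, HasDerivAt p (pd t) t) (hm' : ∀ t, HasDerivAt m (md t) t)
    (hpd : ∀ t ∈ Icc 0 t₁, pd t ≤ -μ * p t + 18 * ρ ^ 2 / μ * (p t + m t) + 2 * (L * r) ^ 2 / μ * φ (σ t) ^ 2)
    (hmd : ∀ t ∈ Icc 0 t₁, μ * m t - 18 * ρ ^ 2 / μ * (p t + m t) - 2 * (L * r) ^ 2 / μ * φ (σ t) ^ 2 ≤ md t)
    (hσ' : ∀ t, HasDerivAt σ (-φ (σ t) - ⟪e, selfSimilarTransport γ c U (Y t) - φ (σ t) • e - A (ξ t)⟫) t)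
    (hE : ∀ t ∈ Icc 0 t₁, ‖selfSimilarTransport γ c U (Y t) - φ (σ t) • e - A (ξ t)‖ ≤ ρ * ‖ξ t‖)
    -- trajectory maximum and threshold
    {M₁ Θ κ η : ℝ} (hM₁0 : 0 ≤ M₁)
    (hκ : κ = 512 * η ^ 2 / ((1 - 2 * γ) ^ 2 * μ ^ 2) + 16 * (1 + K) * (L * r) ^ 2 / μ ^ 2)
    (hΘ : Θ = κ * M₁ ^ 2 + 9 * (1 + K) * ε ^ 2)
    (hρ1 : 18 * ρ ^ 2 / μ * (1 + K) ≤ μ / 16)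
    -- case hypotheses and the smallness used here
    (hsmall : ∀ t ∈ Icc 0 t₁, p t + m t < 2 * (1 + K) * Θ) (hσ₁ : r / 2 ≤ σ t₁)
    (harc : ∀ τ ∈ Icc (r / 4) (r / 2), φ τ = 0) (hM₁r : M₁ ≤ C₁ * r ^ 2)
    (hrArc : 6 * ρ * (1 + K) * Real.sqrt (2 * κ) * C₁ * r ≤ μ / 16)
    (hεArc : 6 * ρ * (1 + K) * Real.sqrt 2 * 3 * Real.sqrt (1 + K) * ε ≤ μ * r / 16) : False := by
  classical
  set V := selfSimilarTransport γ c U with hV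
  have hKge1 : 1 ≤ K := by
    have : 0 ≤ 2 * α / μ := div_nonneg (by linarith) hμ.le
    rw [hK]; linarith
  have hee : ⟪e, e⟫ = 1 := by rw [real_inner_self_eq_norm_sq, he1]; norm_num
  have hσc : Continuous σ := by
    have hYc : Continuous Y := continuous_iff_continuousAt.2 fun t => (hY t).continuousAt
    have : σ = fun t => ⟪e, Y t - z⟫ := funext hσ
    rw [this]; exact continuous_const.inner (hYc.sub continuous_const)
  have hσ0 : σ 0 < r / 4 := by
    have : |σ 0| ≤ ε := by
      rw [hσ 0]; exact ((abs_real_inner_le_norm e _).trans (by rw [he1, one_mul])).trans hY0.le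
    linarith [(abs_le.1 this).2]
  have hσle : ∀ t ∈ Icc 0 t₁, |σ t| ≤ r := fun t ht => by
    rw [hσ t]; exact ((abs_real_inner_le_norm e _).trans (by rw [he1, one_mul])).trans (hin t ht)
  /- ── the last crossing `[t_in, t_out]` of the slab `[r/4, r/2]` ── -/
  set Sin : Set ℝ := {t | t ∈ Icc 0 t₁ ∧ σ t ≤ r / 4} with hSin
  have hSin_ne : Sin.Nonempty := ⟨0, ⟨le_rfl, ht₁.le⟩, hσ0.le⟩
  have hSin_bdd : BddAbove Sin := ⟨t₁, fun t ht => ht.1.2⟩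
  have hSin_cl : IsClosed Sin := by
    have : Sin = Icc 0 t₁ ∩ σ ⁻¹' Iic (r / 4) := by
      ext t; simp only [hSin, mem_setOf_eq, mem_inter_iff, mem_preimage, mem_Iic]
    rw [this]; exact (hσc.continuousOn).preimage_isClosed_of_isClosed isClosed_Icc isClosed_Iic
  set tin := sSup Sin with htin
  have htinS : tin ∈ Sin := hSin_cl.csSup_mem hSin_ne hSin_bdd
  have htin0 : 0 ≤ tin := htinS.1.1
  have htin1 : tin ≤ t₁ := htinS.1.2
  have hσtin_le : σ tin ≤ r / 4 := htinS.2
  have htin_lt : tin < t₁ := by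
    rcases htin1.eq_or_lt with h1 | h1
    · rw [h1] at hσtin_le; linarith
    · exact h1
  have hafter : ∀ t ∈ Ioc tin t₁, r / 4 < σ t := by
    intro t ht
    by_contra hle
    push Not at hle
    exact absurd (le_csSup hSin_bdd ⟨⟨htin0.trans ht.1.le, ht.2⟩, hle⟩) (not_le.2 ht.1)
  have hσtin : σ tin = r / 4 := by
    -- continuity from the right
    refine le_antisymm hσtin_le ?_
    have hcw : ContinuousWithinAt σ (Ioo tin t₁) tin := hσc.continuousAt.continuousWithinAt
    haveI : (𝓝[Ioo tin t₁] tin).NeBot :=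
      mem_closure_iff_nhdsWithin_neBot.1 (by rw [closure_Ioo htin_lt.ne]; exact ⟨le_rfl, htin_lt.le⟩)
    exact ge_of_tendsto hcw.tendsto
      (eventually_nhdsWithin_of_forall fun s hs => (hafter s ⟨hs.1, hs.2.le⟩).le)
  set Sout : Set ℝ := {t | t ∈ Icc tin t₁ ∧ r / 2 ≤ σ t} with hSout
  have hSout_ne : Sout.Nonempty := ⟨t₁, ⟨htin1, le_rfl⟩, hσ₁⟩
  have hSout_bdd : BddBelow Sout := ⟨tin, fun t ht => ht.1.1⟩
  have hSout_cl : IsClosed Sout := by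
    have : Sout = Icc tin t₁ ∩ σ ⁻¹' Ici (r / 2) := by
      ext t; simp only [hSout, mem_setOf_eq, mem_inter_iff, mem_preimage, mem_Ici]
    rw [this]; exact (hσc.continuousOn).preimage_isClosed_of_isClosed isClosed_Icc isClosed_Ici
  set tout := sInf Sout with htout
  have htoutS : tout ∈ Sout := hSout_cl.csInf_mem hSout_ne hSout_bdd
  have htout0 : tin ≤ tout := htoutS.1.1
  have htout1 : tout ≤ t₁ := htoutS.1.2
  have hσtout_ge : r / 2 ≤ σ tout := htoutS.2
  have htout_gt : tin < tout := by
    rcases htout0.eq_or_lt with h1 | h1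
    · rw [← h1] at hσtout_ge; linarith
    · exact h1
  have hbefore : ∀ t ∈ Ico tin tout, σ t < r / 2 := by
    intro t ht
    by_contra hge
    push Not at hge
    exact absurd (csInf_le hSout_bdd ⟨⟨ht.1, ht.2.le.trans htout1⟩, hge⟩) (not_le.2 ht.2)
  have hσtout : σ tout = r / 2 := by
    refine le_antisymm ?_ hσtout_ge
    have hcw : ContinuousWithinAt σ (Ioo tin tout) tout := hσc.continuousAt.continuousWithinAt
    haveI : (𝓝[Ioo tin tout] tout).NeBot :=
      mem_closure_iff_nhdsWithin_neBot.1 (by rw [closure_Ioo htout_gt.ne]; exact ⟨htout_gt.le, le_rfl⟩)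
    exact le_of_tendsto hcw.tendsto
      (eventually_nhdsWithin_of_forall fun s hs => (hbefore s ⟨hs.1.le, hs.2⟩).le)
  have hslab : ∀ t ∈ Icc tin tout, σ t ∈ Icc (r / 4) (r / 2) := by
    intro t ht
    constructor
    · rcases ht.1.eq_or_lt with h1 | h1
      · rw [← h1, hσtin]
      · exact (hafter t ⟨h1, ht.2.trans htout1⟩).le
    · rcases ht.2.eq_or_lt with h1 | h1
      · rw [h1, hσtout]
      · exact (hbefore t ⟨ht.1, h1⟩).le
  have hsub : Icc tin tout ⊆ Icc 0 t₁ := Icc_subset_Icc htin0 htout1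
  have hφ0 : ∀ t ∈ Icc tin tout, φ (σ t) = 0 := fun t ht => harc _ (hslab t ht)
  /- ── on the slab: unforced inequalities, `ξ ≠ 0`, drift `≤ ρ√(p+m)` ── -/
  set cst : ℝ := 18 * ρ ^ 2 / μ with hcst
  have hξne : ∀ t ∈ Icc tin tout, 0 < p t + m t := by
    intro t ht
    rw [hpm t]
    apply pow_pos (norm_pos_iff.2 _)
    intro h0
    have e1 : Y t = z + σ t • e + g (σ t) := by
      have := hξ t; rw [h0] at this
      have : Y t - z - σ t • e - g (σ t) = 0 := this.symm
      calc Y t = (Y t - z - σ t • e - g (σ t)) + (z + σ t • e + g (σ t)) := by abel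
        _ = z + σ t • e + g (σ t) := by rw [this, zero_add]
    have hVY : V (Y t) = 0 := by
      rw [e1, hpar (σ t) ((hσle t (hsub ht)).trans (by linarith)), hφ0 t ht, zero_smul]
    exact hstag t (hsub ht) hVY
  have hσd : ∀ t ∈ Icc tin tout, |(-φ (σ t) - ⟪e, V (Y t) - φ (σ t) • e - A (ξ t)⟫)| ≤
      ρ * Real.sqrt (p t + m t) := by
    intro t ht
    rw [hφ0 t ht, neg_zero, zero_sub, abs_neg, hpm t, Real.sqrt_sq (norm_nonneg _)]
    have h1 := hE t (hsub ht)
    rw [hφ0 t ht] at h1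
    exact ((abs_real_inner_le_norm _ _).trans (by rw [he1, one_mul])).trans h1
  /- ── the shifted travel bound ── -/
  set T := tout - tin with hT
  have hT0 : 0 ≤ T := by rw [hT]; linarith
  have hshift : ∀ s ∈ Icc 0 T, tin + s ∈ Icc tin tout := fun s hs =>
    ⟨by linarith [hs.1], by rw [hT] at hs; linarith [hs.2]⟩
  have htravel := slab_travel_le (p := fun s => p (tin + s)) (m := fun s => m (tin + s))
    (σ := fun s => σ (tin + s)) (K := K) (μ := μ) (c := cst) (ρ := ρ) (S := 2 * (1 + K) * Θ) (T := T)
    hKge1 hμ (by positivity) (by rw [hcst]; linarith [hρ1]) hρ.le hT0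
    (fun s => (hp' (tin + s)).comp_const_add tin s) (fun s => (hm' (tin + s)).comp_const_add tin s)
    (fun s => (hσ' (tin + s)).comp_const_add tin s)
    (fun s => hpnn _) (fun s => hmnn _) (fun s hs => hξne _ (hshift s hs))
    (fun s hs => by
      have h1 := hpd (tin + s) (hsub (hshift s hs))
      rw [hφ0 _ (hshift s hs)] at h1
      simp only [hcst]; linarith)
    (fun s hs => by
      have h1 := hmd (tin + s) (hsub (hshift s hs))
      rw [hφ0 _ (hshift s hs)] at h1
      simp only [hcst]; linarith)
    (fun s hs => hσd _ (hshift s hs))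
    (fun s hs => (hsmall _ (hsub (hshift s hs))).le)
  simp only [hT, add_sub_cancel, add_zero] at htravel
  rw [hσtout, hσtin] at htravel
  have hquarter : r / 4 ≤ 6 * ρ * Real.sqrt ((1 + K) * (2 * (1 + K) * Θ)) / μ := by
    have : |r / 2 - r / 4| = r / 4 := by rw [abs_of_nonneg (by linarith)]; ring
    linarith [htravel, this.symm.le, this.le]
  /- ── the travel bound is `≤ r/8`: contradiction ── -/
  have hκ0 : 0 ≤ κ := by rw [hκ]; positivity
  have hΘ0 : 0 ≤ Θ := by rw [hΘ]; positivity
  have hsqΘ : Real.sqrt Θ ≤ Real.sqrt κ * M₁ + 3 * Real.sqrt (1 + K) * ε := by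
    rw [hΘ]; exact sqrt_threshold_le hκ0 hM₁0 (by linarith) hε.le
  have e1 : Real.sqrt ((1 + K) * (2 * (1 + K) * Θ)) = (1 + K) * Real.sqrt 2 * Real.sqrt Θ := by
    rw [show (1 + K) * (2 * (1 + K) * Θ) = (1 + K) ^ 2 * (2 * Θ) by ring,
      Real.sqrt_mul (by positivity), Real.sqrt_sq (by linarith), Real.sqrt_mul (by norm_num)]
    ring
  rw [e1] at hquarter
  have h2 : 6 * ρ * ((1 + K) * Real.sqrt 2 * Real.sqrt Θ) / μ ≤
      6 * ρ * ((1 + K) * Real.sqrt 2 * (Real.sqrt κ * M₁ + 3 * Real.sqrt (1 + K) * ε)) / μ := by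
    apply div_le_div_of_nonneg_right _ hμ.le
    apply mul_le_mul_of_nonneg_left _ (by positivity)
    exact mul_le_mul_of_nonneg_left hsqΘ (by positivity)
  -- first part: `6ρ(1+K)√2√κ M₁/μ ≤ r/16`
  have hs2κ : Real.sqrt 2 * Real.sqrt κ = Real.sqrt (2 * κ) := (Real.sqrt_mul (by norm_num) κ).symm
  have h3 : 6 * ρ * (1 + K) * Real.sqrt 2 * Real.sqrt κ * M₁ ≤ μ * r / 16 := by
    have h4 : 6 * ρ * (1 + K) * Real.sqrt 2 * Real.sqrt κ * M₁ ≤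
        6 * ρ * (1 + K) * Real.sqrt 2 * Real.sqrt κ * (C₁ * r ^ 2) :=
      mul_le_mul_of_nonneg_left hM₁r (by positivity)
    have h5 : 6 * ρ * (1 + K) * Real.sqrt 2 * Real.sqrt κ * (C₁ * r ^ 2) =
        (6 * ρ * (1 + K) * Real.sqrt (2 * κ) * C₁ * r) * r := by rw [← hs2κ]; ring
    have h6 := mul_le_mul_of_nonneg_right hrArc hr.le
    linarith
  -- second part: `6ρ(1+K)√2·3√(1+K)ε/μ ≤ r/16`
  have h7 : 6 * ρ * (1 + K) * Real.sqrt 2 * (3 * Real.sqrt (1 + K) * ε) ≤ μ * r / 16 := by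
    linarith [hεArc]
  have h8 : 6 * ρ * ((1 + K) * Real.sqrt 2 * (Real.sqrt κ * M₁ + 3 * Real.sqrt (1 + K) * ε)) / μ ≤ r / 8 := by
    rw [div_le_iff₀ hμ]
    have : 6 * ρ * ((1 + K) * Real.sqrt 2 * (Real.sqrt κ * M₁ + 3 * Real.sqrt (1 + K) * ε)) =
        6 * ρ * (1 + K) * Real.sqrt 2 * Real.sqrt κ * M₁ +
          6 * ρ * (1 + K) * Real.sqrt 2 * (3 * Real.sqrt (1 + K) * ε) := by ring
    rw [this]; linarith
  linarith

end Summit.NavierStokesRegularity.NavierStokesRegularity.Theorems.PowerGaugeEulerLiouville.NodalContinuum
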